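import Summits.KontsevichZagierPeriods.Statement
import Summits.KontsevichZagierPeriods.KontsevichZagierPeriods.Theses.Neg

/-!
# KontsevichZagierPeriods / route Neg — the assembly (item stmt-KontsevichZagierPeriods-11008)

Settles the assembly item `Assembly` of route Neg:
`(NegTriplicationNotAccessible ∨ CancellationGap) → TriplicationValueEq → ¬ KontsevichZagierPeriods`.
Either witness of the route refutes the literal Kontsevich–Zagier statement:

* branch `CancellationGap` is the route's deciding theorem `Neg.closes` (proved in the route file:
  Fubini for the hand-written product representations, soundness of the moves, cancellation of the
  non-zero real number `∫ s`, passage to move-equivalent rational representations, the summit);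
* branch `NegTriplicationNotAccessible`: given the Gauss-triplication pair `r`, `r'` (pinned by
  domain and integrand), `TriplicationValueEq` gives `r.value = r'.value`; by
  `KZ.exists_isRational_equivalent_holds` (Tarski–Seidenberg, proved) each is move-equivalent to a
  representation of KZ's rational shape, with the same value by soundness of the moves
  (`KZ.Equivalent.value_eq_holds`); the summit connects the two rational representations, and
  composing (`Equivalent.trans` / `Equivalent.symm`) gives `KZ.Equivalent r r'`, contradicting the
  crux.

Sources: M. Kontsevich, D. Zagier, *Periods* (2001), §1.1 (remark after the Definition) and §1.2
(the three rules and Conjecture 1). Deliberately NOT here: either crux itself, and the value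
identity `TriplicationValueEq` (Gauss 1812; its own support item).
-/

namespace Summit.KontsevichZagierPeriods.Neg

open Literature.NumberTheory.Transcendental

/-- The positive spine behind branch 1 of the assembly: under the summit `KontsevichZagierPeriods`,
ANY two integral representations (of any dimensions, not necessarily of rational shape) with the
same value are connected by the moves — reduce each to a move-equivalent rational-shape
representation (`KZ.exists_isRational_equivalent_holds`), transport the values along the moves
(`KZ.Equivalent.value_eq_holds`), apply the summit, and compose.
[Kontsevich–Zagier 2001, §1.1 remark after the Definition, §1.2] [folklore] -/
theorem equivalent_of_value_eq_of_summit (hS : KontsevichZagierPeriods) {n m : ℕ}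
    (r : KZ.IntegralRep n) (r' : KZ.IntegralRep m) (hv : r.value = r'.value) :
    KZ.Equivalent r r' := by
  obtain ⟨m₁, t, ht, hrt⟩ := KZ.exists_isRational_equivalent_holds r
  obtain ⟨m₂, t', ht', hrt'⟩ := KZ.exists_isRational_equivalent_holds r'
  have htt' : t.value = t'.value := by
    rw [← KZ.Equivalent.value_eq_holds hrt, ← KZ.Equivalent.value_eq_holds hrt']
    exact hv
  exact (hrt.trans (hS t t' ht ht' htt')).trans hrt'.symm

/-- Settles item stmt-KontsevichZagierPeriods-11008 (`Assembly`), route Neg: either witness of the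
route — the crux `NegTriplicationNotAccessible` (the Gauss-triplication pair is not connected by
the moves) together with the value identity `TriplicationValueEq`, or the crux `CancellationGap`
alone — refutes `KontsevichZagierPeriods`. Branch 1: the summit connects any two equal-valued
representations (`equivalent_of_value_eq_of_summit`), in particular the pinned pair, contradicting
the crux; branch 2 is the route's deciding theorem `Neg.closes`.
[Kontsevich–Zagier 2001, §1.2] [folklore] -/
theorem assembly_proof :
    Summit.KontsevichZagierPeriods.KontsevichZagierPeriods.Theses.Neg.Assembly := by
  unfold Summit.KontsevichZagierPeriods.KontsevichZagierPeriods.Theses.Neg.Assembly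
  intro h hV hS
  rcases h with h | h
  · exact h fun r r' hd hf hd' hf' =>
      equivalent_of_value_eq_of_summit hS r r' (hV r r' hd hf hd' hf')
  · exact Summit.KontsevichZagierPeriods.KontsevichZagierPeriods.Theses.Neg.closes h hS

end Summit.KontsevichZagierPeriods.Neg
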